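import Mathlib
import Summits.Ventures.HodgeRepro2.Tier7.Line1.SepShadow

/-!
# Tier7/Line1/SepOmega — the theta-lift summands `ω_i` of the separating datum

The SEPARATING DATUM of t7-L1-p2 (LINE L1, residual probe). `G` acts on `U` through the flips and signs
(`genU`, the index generators act trivially), compatibly with the embedding `ιA : U → HXS J` of the holomorphic
classes of the first curve (`smul_ιA`). The summands: `omegaA s = ιA(Wmod s)` for `s = 0, sq` (Hecke-irreducible
by the simplicity `Wmod_eq_of_stable` of `SepWeightSimple`) and `E2 = ⟨e₀, e₁⟩` of the second curve
(Hecke-irreducible through the swap and the index sign). Author: t7-L1-p2 (prover-pub-hodge-repro2-t7-L1-p2-g0-0).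
§8(d): NO.
-/

namespace Summit.Ventures.HodgeRepro2.Tier7.Line1.Sep

open Finset Summit.Ventures.HodgeRepro2.Tier7

noncomputable section

variable {J : Type} [AddCommGroup J] [Module ℂ J]

/-! ## Stability from the generators -/

/-- a subspace stable under the generators is Hecke-stable -/
theorem heckeStable_of_gen {X : Submodule ℂ (HXS J)} (h : ∀ s, ∀ a ∈ X, gen J s a ∈ X) :
    HeckeStable G X :=
  lift_gen_prop (J := J) (fun φ => ∀ a ∈ X, φ a ∈ X) (fun a ha => by simpa using ha) h
    (fun φ ψ hφ hψ a ha => by rw [AlgEquiv.mul_apply]; exact hφ _ (hψ a ha))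

/-! ## The action of `G` on `U` -/

/-- the generators on `U`: the flips and signs; the index generators act trivially -/
def genU : Bool × Option ℕ → (U ≃ₗ[ℂ] U)
  | (false, some n) => flipU n
  | (true, some n) => sgnU n
  | (false, none) => LinearEquiv.refl ℂ U
  | (true, none) => LinearEquiv.refl ℂ U

/-- the action of `G` on `U` -/
instance : DistribMulAction G U := DistribMulAction.compHom U (FreeGroup.lift genU)

/-- the action on `U` unfolded -/
theorem smul_def_U (g : G) (u : U) : g • u = FreeGroup.lift genU g u := rfl

/-- a generator acts on `U` by itself -/
theorem of_smul_U (s : Bool × Option ℕ) (u : U) : FreeGroup.of s • u = genU s u := by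
  simp [smul_def_U]

/-- the action on `U` is `ℂ`-linear -/
theorem smul_comm_U (g : G) (c : ℂ) (u : U) : g • (c • u) = c • (g • u) :=
  map_smul (FreeGroup.lift genU g) c u

/-- the generators on `U` are involutions -/
theorem genU_genU (s : Bool × Option ℕ) (u : U) : genU s (genU s u) = u := by
  rcases s with ⟨b, n⟩
  rcases b with _ | _ <;> rcases n with _ | n
  · rfl
  · exact flipU_flipU n u
  · rfl
  · exact sgnU_sgnU n u

/-- `ιA` as a linear map -/
def ιAL : U →ₗ[ℂ] HXS J where
  toFun := ιA
  map_add' u w := by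
    refine Curve.ext (holA_add u w) ?_ ?_ ?_ <;> simp [ιA]
  map_smul' c u := by
    refine Curve.ext ?_ ?_ ?_ ?_
    · exact holA_smul c u
    · simp [ιA]
    · simp [ιA]
    · simp [ιA]

/-- `ιAL` unfolded -/
@[simp] theorem ιAL_apply (u : U) : (ιAL u : HXS J) = ιA u := rfl

/-- `ιA` is injective -/
theorem ιA_injective : Function.Injective (ιA (J := J)) := by
  intro u w h
  exact holA_injective (congrArg Curve.c h)

/-- the generators act on `ιA u` through `genU` -/
theorem gen_ιA (s : Bool × Option ℕ) (u : U) : gen J s (ιA u) = ιA (genU s u) := by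
  rcases s with ⟨b, n⟩
  rcases b with _ | _ <;> rcases n with _ | n
  · simp only [gen, genData, genU, HAutData.algEquiv_apply, HAutData.swap, ιA]
    refine Curve.ext rfl ?_ rfl rfl
    ext k <;> simp [HAutData.actFun]
  · simp only [gen, genData, genU, HAutData.algEquiv_apply, HAutData.ofUAut, ιA]
    refine Curve.ext ?_ ?_ ?_ rfl
    · exact (UAut.flip n).algEquiv₁_holA u
    · ext k <;> simp [HAutData.actFun]
    · simp
  · simp only [gen, genData, genU, HAutData.algEquiv_apply, HAutData.sign, ιA]
    refine Curve.ext rfl ?_ rfl rfl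
    ext k <;> simp [HAutData.actFun]
  · simp only [gen, genData, genU, HAutData.algEquiv_apply, HAutData.ofUAut, ιA]
    refine Curve.ext ?_ ?_ ?_ rfl
    · exact (UAut.sgn n).algEquiv₁_holA u
    · ext k <;> simp [HAutData.actFun]
    · simp

/-- THE TRANSFER for the first curve: `G` acts on `ιA(U)` through its action on `U` -/
theorem smul_ιA (g : G) (u : U) : g • (ιA u : HXS J) = ιA (g • u) := by
  induction g using FreeGroup.induction_on generalizing u with
  | C1 => rw [one_smul, one_smul]
  | of s => rw [of_smul, of_smul_U, gen_ιA]
  | inv_of s ih =>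
    have h := ih ((FreeGroup.of s)⁻¹ • u)
    rw [smul_inv_smul] at h
    rw [← h, inv_smul_smul]
  | mul a b ha hb => rw [mul_smul, mul_smul, hb, ha]

/-! ## `Wmod s` inside `U` -/

/-- `Wmod s` as a subspace of `U` -/
def WU (s : ℕ → ℂ) : Submodule ℂ U := (Wmod s).comap Usub.subtype

/-- membership in `WU s` -/
theorem mem_WU {s : ℕ → ℂ} {u : U} : u ∈ WU s ↔ (u : Ω → ℂ) ∈ Wmod s := Iff.rfl

/-- the generators preserve `WU s` -/
theorem genU_mem_WU (s : ℕ → ℂ) (t : Bool × Option ℕ) {u : U} (hu : u ∈ WU s) : genU t u ∈ WU s := by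
  rcases t with ⟨b, n⟩
  rcases b with _ | _ <;> rcases n with _ | n
  · exact hu
  · exact (Wmod_stable s).flip_mem n _ hu
  · exact hu
  · exact (Wmod_stable s).sgn_mem n _ hu

/-- `G` preserves `WU s` -/
theorem smul_mem_WU (s : ℕ → ℂ) (g : G) {u : U} (hu : u ∈ WU s) : g • u ∈ WU s := by
  induction g using FreeGroup.induction_on generalizing u with
  | C1 => simpa using hu
  | of t => rw [of_smul_U]; exact genU_mem_WU s t hu
  | inv_of t _ =>
    have hinv : (FreeGroup.of t)⁻¹ • u = genU t u := by
      rw [inv_smul_eq_iff, of_smul_U, genU_genU]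
    rw [hinv]; exact genU_mem_WU s t hu
  | mul a b ha hb => rw [mul_smul]; exact ha (hb hu)

/-- `wt s` as an element of `U` -/
def wtU (s : ℕ → ℂ) (hs : Wmod s ≤ Usub) : U := ⟨wt s, hs (level_le_Wmod s ∅ (wt_mem_level s))⟩

/-- `wtU s ∈ WU s` -/
theorem wtU_mem_WU (s : ℕ → ℂ) (hs : Wmod s ≤ Usub) : wtU s hs ∈ WU s :=
  level_le_Wmod s ∅ (wt_mem_level s)

/-- `wtU s ≠ 0` -/
theorem wtU_ne_zero (s : ℕ → ℂ) (hs : Wmod s ≤ Usub) : wtU s hs ≠ 0 := fun h =>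
  wt_ne_zero s (congrArg Subtype.val h)

/-! ## The summands of the first curve -/

/-- the theta-lift summand `ω(s) = ιA(Wmod s)` -/
def omegaA (s : ℕ → ℂ) : Submodule ℂ (HXS J) := (WU s).map ιAL

/-- membership in `omegaA s` -/
theorem mem_omegaA {s : ℕ → ℂ} {a : HXS J} : a ∈ omegaA s ↔ ∃ u ∈ WU s, ιA u = a :=
  Submodule.mem_map

/-- `ιA u ∈ omegaA s` for `u ∈ WU s` -/
theorem ιA_mem_omegaA {s : ℕ → ℂ} {u : U} (hu : u ∈ WU s) : (ιA u : HXS J) ∈ omegaA s :=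
  mem_omegaA.2 ⟨u, hu, rfl⟩

/-- `omegaA s ≤ H10` -/
theorem omegaA_le_H10 (s : ℕ → ℂ) : omegaA s ≤ (H10 : Submodule ℂ (HXS J)) := by
  rintro _ ⟨u, _, rfl⟩
  exact ιA_mem_H10 u

/-- `omegaA s` is Hecke-stable -/
theorem heckeStable_omegaA (s : ℕ → ℂ) : HeckeStable G (omegaA s (J := J)) := by
  rintro g _ ⟨u, hu, rfl⟩
  rw [ιAL_apply, smul_ιA]
  exact ιA_mem_omegaA (smul_mem_WU s g hu)

/-- `omegaA s ≠ ⊥` -/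
theorem omegaA_ne_bot (s : ℕ → ℂ) (hs : Wmod s ≤ Usub) : omegaA s (J := J) ≠ ⊥ := by
  intro h
  have hmem : (ιA (wtU s hs) : HXS J) ∈ omegaA s := ιA_mem_omegaA (wtU_mem_WU s hs)
  rw [h, Submodule.mem_bot] at hmem
  exact wtU_ne_zero s hs (ιA_injective (hmem.trans (map_zero ιAL).symm))

/-- the `U`-vectors of a subspace of `ιA(U)`, as functions on `Ω` -/
def coordA (W : Submodule ℂ (HXS J)) : Submodule ℂ (Ω → ℂ) := (W.comap ιAL).map Usub.subtype

/-- `coordA` of a Hecke-stable subspace is stable under the flips and signs -/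
theorem stable_coordA {W : Submodule ℂ (HXS J)} (hW : HeckeStable G W) : Stable (coordA W) where
  flip_mem n f hf := by
    obtain ⟨u, hu, rfl⟩ := hf
    refine ⟨flipU n u, ?_, rfl⟩
    have := hW (FreeGroup.of (false, some n)) _ hu
    rwa [ιAL_apply, smul_ιA, of_smul_U] at this
  sgn_mem n f hf := by
    obtain ⟨u, hu, rfl⟩ := hf
    refine ⟨sgnU n u, ?_, rfl⟩
    have := hW (FreeGroup.of (true, some n)) _ hu
    rwa [ιAL_apply, smul_ιA, of_smul_U] at this

/-- `omegaA s` is Hecke-irreducible -/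
theorem heckeIrred_omegaA (s : ℕ → ℂ) (hs : Wmod s ≤ Usub) : HeckeIrred G (omegaA s (J := J)) := by
  refine ⟨omegaA_ne_bot s hs, heckeStable_omegaA s, fun W hW hWs => ?_⟩
  have hle : coordA W ≤ Wmod s := by
    rintro _ ⟨u, hu, rfl⟩
    obtain ⟨u', hu', huu'⟩ := mem_omegaA.1 (hW hu)
    rw [ιA_injective huu'] at hu'
    exact hu'
  rcases eq_or_ne (coordA W) ⊥ with h | h
  · left
    rw [eq_bot_iff]
    intro a ha
    obtain ⟨u, _, rfl⟩ := mem_omegaA.1 (hW ha)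
    have : (u : Ω → ℂ) ∈ coordA W := ⟨u, ha, rfl⟩
    rw [h, Submodule.mem_bot] at this
    rw [Submodule.mem_bot, show u = 0 from Subtype.ext this, ← ιAL_apply, map_zero]
  · right
    have hQ := Wmod_eq_of_stable (stable_coordA hWs) hle h
    refine le_antisymm hW ?_
    rintro _ ⟨u, hu, rfl⟩
    have : (u : Ω → ℂ) ∈ coordA W := by rw [hQ]; exact hu
    obtain ⟨u', hu', huu'⟩ := this
    rw [show u = u' from Subtype.ext huu'.symm]
    exact hu'

/-! ## The summand of the second curve -/

/-- `E2 = ⟨e₀, e₁⟩` -/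
def E2 : Submodule ℂ (HXS J) := Submodule.span ℂ {eH 0, eH 1}

/-- `eH k ∈ E2` -/
theorem eH_mem_E2 (k : Fin 2) : (eH k : HXS J) ∈ E2 := by
  fin_cases k
  · exact Submodule.subset_span (Set.mem_insert _ _)
  · exact Submodule.subset_span (Set.mem_insert_of_mem _ rfl)

/-- `E2 ≤ H10` -/
theorem E2_le_H10 : E2 ≤ (H10 : Submodule ℂ (HXS J)) := by
  rw [E2, Submodule.span_le]
  rintro _ (rfl | rfl)
  · exact eH_mem_H10 0
  · exact eH_mem_H10 1

/-- `actFun 0 = 0` -/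
theorem HAutData.actFun_zero (D : HAutData) : D.actFun 0 = 0 := by
  funext k; simp [HAutData.actFun]

/-- a generator on `e k` -/
theorem HAutData.algEquiv_eH (D : HAutData) (k : Fin 2) :
    D.algEquiv (eH k : HXS J) = D.ε (D.π.symm k) • eH (D.π.symm k) := by
  rw [HAutData.algEquiv_apply]
  simp only [eH, map_zero]
  refine Curve.ext (by simp) ?_ (by simp) (by simp)
  refine Prod.ext (funext fun j => ?_) (by simp [HAutData.actFun_zero])
  simp only [HAutData.actFun_apply, Pi.single_apply]
  by_cases h : j = D.π.symm k
  · subst h; simp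
  · have h' : D.π j ≠ k := fun hk => h (by rw [← hk, Equiv.symm_apply_apply])
    simp [h, h']

/-- the flips and signs fix `e k` -/
theorem gen_eH_of_some (b : Bool) (n : ℕ) (k : Fin 2) : gen J (b, some n) (eH k) = eH k := by
  rw [gen, HAutData.algEquiv_eH]
  cases b
  · show (1 : Fin 2 → ℂ) k • (eH k : HXS J) = eH k
    simp
  · show (1 : Fin 2 → ℂ) k • (eH k : HXS J) = eH k
    simp

/-- the swap moves `e k` -/
theorem gen_eH_swap (k : Fin 2) : gen J (false, none) (eH k) = eH (Equiv.swap 0 1 k) := by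
  rw [gen, HAutData.algEquiv_eH]
  show (1 : Fin 2 → ℂ) _ • (eH ((Equiv.swap 0 1).symm k) : HXS J) = eH (Equiv.swap 0 1 k)
  simp [Equiv.symm_swap]

/-- the index sign on `e k` -/
theorem gen_eH_sign (k : Fin 2) : gen J (true, none) (eH k) = signK k • eH k := by
  rw [gen, HAutData.algEquiv_eH]
  rfl

/-- every generator maps `e k` into `E2` -/
theorem gen_eH_mem_E2 (s : Bool × Option ℕ) (k : Fin 2) : gen J s (eH k) ∈ E2 := by
  rcases s with ⟨b, n⟩
  rcases n with _ | n
  · cases b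
    · rw [gen_eH_swap]; exact eH_mem_E2 _
    · rw [gen_eH_sign]; exact E2.smul_mem _ (eH_mem_E2 k)
  · rw [gen_eH_of_some]; exact eH_mem_E2 k

/-- `E2` is Hecke-stable -/
theorem heckeStable_E2 : HeckeStable G (E2 (J := J)) := by
  refine heckeStable_of_gen fun s a ha => ?_
  obtain ⟨p, q, rfl⟩ := Submodule.mem_span_pair.1 ha
  rw [map_add, map_smul, map_smul]
  exact E2.add_mem (E2.smul_mem _ (gen_eH_mem_E2 s 0)) (E2.smul_mem _ (gen_eH_mem_E2 s 1))

/-- the coordinates of `p • e₀ + q • e₁` -/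
theorem coeff_eH (p q : ℂ) (k : Fin 2) :
    ((p • (eH 0 : HXS J) + q • eH 1).v.1 k) = algebraMap ℂ A₁ (![p, q] k) := by
  fin_cases k <;> simp [eH, Algebra.smul_def]

/-- `p • e₀ + q • e₁ = 0` forces `p = q = 0` -/
theorem eH_linearIndependent {p q : ℂ} (h : p • (eH 0 : HXS J) + q • eH 1 = 0) : p = 0 ∧ q = 0 := by
  have h0 := congrArg (fun x : HXS J => x.v.1 0) h
  have h1 := congrArg (fun x : HXS J => x.v.1 1) h
  simp only [coeff_eH] at h0 h1
  refine ⟨?_, ?_⟩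
  · have := congrArg Curve.c h0
    simpa using this
  · have := congrArg Curve.c h1
    simpa using this

/-- `E2 ≠ ⊥` -/
theorem E2_ne_bot : E2 (J := J) ≠ ⊥ := by
  intro h
  have := eH_mem_E2 (J := J) 0
  rw [h, Submodule.mem_bot] at this
  have h2 : (1 : ℂ) • (eH 0 : HXS J) + (0 : ℂ) • eH 1 = 0 := by rw [this]; simp
  exact one_ne_zero (eH_linearIndependent h2).1

/-- `E2` is Hecke-irreducible -/
theorem heckeIrred_E2 : HeckeIrred G (E2 (J := J)) := by
  refine ⟨E2_ne_bot, heckeStable_E2, fun W hW hWs => ?_⟩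
  rcases eq_or_ne W ⊥ with h | h
  · exact Or.inl h
  right
  obtain ⟨w, hw, hw0⟩ := (Submodule.ne_bot_iff W).1 h
  obtain ⟨p, q, rfl⟩ := Submodule.mem_span_pair.1 (hW hw)
  have key : ∀ k, (eH k : HXS J) ∈ W → W = E2 := by
    intro k hk
    have hk' : (eH (Equiv.swap 0 1 k) : HXS J) ∈ W := by
      rw [← gen_eH_swap, ← of_smul]; exact hWs _ _ hk
    refine le_antisymm hW ?_
    rw [E2, Submodule.span_le]
    rintro _ (rfl | rfl)
    · fin_cases k
      · exact hk
      · simpa using hk'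
    · fin_cases k
      · simpa using hk'
      · exact hk
  -- the index sign isolates the coordinates
  have hs : (FreeGroup.of (true, none) : G) • (p • (eH 0 : HXS J) + q • eH 1) = p • eH 0 - q • eH 1 := by
    rw [of_smul, map_add, map_smul, map_smul, gen_eH_sign, gen_eH_sign]
    simp [signK, sub_eq_add_neg]
  have hsum : (2 * p) • (eH 0 : HXS J) ∈ W := by
    have := W.add_mem hw (hWs (FreeGroup.of (true, none)) _ hw)
    rw [hs] at this
    convert this using 1
    simp only [two_mul, add_smul]; abel
  have hdiff : (2 * q) • (eH 1 : HXS J) ∈ W := by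
    have := W.sub_mem hw (hWs (FreeGroup.of (true, none)) _ hw)
    rw [hs] at this
    convert this using 1
    simp only [two_mul, add_smul]; abel
  by_cases hp : p = 0
  · have hq : q ≠ 0 := fun hq => hw0 (by rw [hp, hq]; simp)
    have := W.smul_mem (2 * q)⁻¹ hdiff
    rw [smul_smul, inv_mul_cancel₀ (mul_ne_zero two_ne_zero hq), one_smul] at this
    exact key 1 this
  · have := W.smul_mem (2 * p)⁻¹ hsum
    rw [smul_smul, inv_mul_cancel₀ (mul_ne_zero two_ne_zero hp), one_smul] at this
    exact key 0 this

end

end Summit.Ventures.HodgeRepro2.Tier7.Line1.Sep
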